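import Mathlib.RingTheory.MvPolynomial.Homogeneous
import Mathlib.LinearAlgebra.LinearIndependent.Defs
import HarnessLib

/-!
# [OURS · L1 W4.2] ROUND-4 BIRTH LAW — the DEFINITIONS: `VanishesToOrder`, `BirthTidy`, `BirthNear` (+ the two band lemmas)
# (cell res-hironaka, LADDER-RESOLUTION rung L; slot W4.2, crux chain w42 `SigmaMaxModificationsCorridor3`
# stmt-ResolutionOfSingularities-19249; `--supports stmt-ResolutionOfSingularities-19249 --as helper`)

PROVENANCE. The five declarations below are res-L1-w42-idea-1's §8 «ROUND-4 BIRTH LAW» of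
`L/res-L1-w42-idea-1/Sketch-L1-idea-1-C3.lean` (sha16 `ea42ede6917f0ca2`, ll. 685–725; the CORRECTED `2d < 3μ` form), landed
VERBATIM (declarations byte-identical; idea-1's docstrings byte-identical except that the two PARAMETERLESS `Prop`s `BirthTidy` /
`BirthNear` drop their trailing `[folklore]` tag — the gate relocates tagged parameterless `Prop`s of Theorems files to `Literature/`,
precedent p496180 / `…Corridor3WLadderMovingDefs`) and except for the namespace
(`…Cruxes.SigmaMaxModifications.IdeasL1C3` ↦ `…Theorems.SigmaMaxModificationsCorridor3.Birth`) and this header, by res-D-pv-002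
on res-L1-w42-plan-1's RULINGS v3.9-2 (I) 2026-08-27T06:03:18Z and res-plan-2's D→L MAP v1.15a. The companion module
`…Corridor3WLadderBirthForms.lean` proves `theorem birthTidy : BirthTidy` and `theorem birthNear : BirthNear`. Everything is OURS
(elementary `MvPolynomial` algebra over a field; no scheme, no `Literature.…` fact, never a `Theses/…` import); NOT a statement of
Hironaka's manuscript [Hironaka2017]. Consumer: idea-1's untidy-birth law for the W-top CORE `stub_Wtop3M_nonpointed`
(K3d frontier). AI-written; no expert review; AI review is weaker than expert review. idea-1's §8 docstring follows.

## §8. ROUND-4 BIRTH LAW — typed first lemmas of the K3d frontier (technique A: the polyhedron decides WHERE near points are born)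

Setting (one chart of one point blow-up; polynomial model of the graded data, which is all the statement uses). `h = Y^m + Σ_{i<m} c_i Y^i`,
`c_i ∈ κ[U₁,U₂,U₃]`-germs with `ord c_i = d_i ≥ m − i` (grade `≥ 1`), `δ_i := d_i/(m − i)`, `δ(Δ) = min_i δ_i > 1` (grade 3, Δ minimal),
`F_i := in(c_i)` (form of degree `d_i` on `ℙ(Dir) ≅ ℙ²`). Blow up the point; `X' ∩ E_red = V(Y') ∩ E = ℙ(Dir) ≅ ℙ²`. In the `U_j`-chart the
new coefficients are `c'_i = U_j^{d_i − (m−i)} (F_i(Û) + U_j·…)` (`Û`: `U_j ↦ 1`), and distinct powers of `U_j` cannot cancel, so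
  (B-near)  `x' = [b]` near (multiplicity still `m`, i.e. `ord_{x'} c'_i ≥ m − i ∀ i`)  ⟹  `mult_{[b]} F_i ≥ 2(m − i) − d_i = (2 − δ_i)(m − i)` ∀ i
(`BirthNear` below, typed). Consequences [OURS]: (B0) the whole `ℙ²` is near iff `δ(Δ) ≥ 2` (PLANE birth; then `δ' = δ − 1` at the generic
point); (B1) a near CURVE of degree `γ` needs `γ·(2 − δ_i)(m − i) ≤ d_i` ∀ i (Bézout against a general line), i.e. `γ ≤ δ/(2 − δ)`: conic
births need `δ ≥ 4/3`, cubic `δ ≥ 3/2`; hence (B-untidy) an UNTIDY near-locus GERM at the next chain point (three or more branches,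
two tangent branches, or a singular branch — the K3d frontier where `Reads`' coordinate-face dictionary fails; two transversal lines are
tidy, a smooth conic is K3b's re-coordinatized move) needs a near curve of total degree `≥ 3`, i.e. `δ(Δ) ≥ 3/2` AT THE BLOWN-UP POINT
(P5: `δ = 8/5`, nodal cubic ✓); (B-collinear) if `δ(Δ) < 6/5` then for the index attaining `δ`, `2·d_i < 3·(2(m−i) − d_i)`, and a NON-ZERO
plane form of degree `d` with `2d < 3μ` cannot vanish to order `μ` at three non-collinear points (`BirthTidy` below; in coordinates making
them the coordinate points every monomial has all exponents `≤ d − μ`, so `d ≤ 3(d − μ)`; SHARP: `(U₀U₁U₂)^k` has `d = 3k`, `μ = 2k`) — so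
all near points lie on ONE LINE of `ℙ(Dir)`, whatever the characteristic and the residue field (apply over `κ^{alg}`). So along a moving
grade-3 chain the dictionary can only break at steps out of a point with `δ ≥ 3/2` — the first quantitative handle on K3d. NOT a statement
of any manuscript; elementary. (v4 erratum: an earlier draft claimed collinearity below `4/3` with `d < 2μ` — false, `(U₀U₁U₂)²`.)
Context only (nothing used): Cossart–Jannsen–Saito 2020 Thm. 3.14 / Lemma 8.1; Cossart–Piltant 2019 Prop. 2.6.
-/

noncomputable section

set_option linter.dupNamespace false

namespace Summit.ResolutionOfSingularities.ResolutionOfSingularities.Theorems.SigmaMaxModificationsCorridor3.Birth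

/-- [OURS] `F` vanishes to order `≥ μ` at the point `b` of `𝔸³` (all homogeneous components of `F(T + b)` of degree `< μ` vanish); for a
FORM `F` and `b ≠ 0` this is the multiplicity `≥ μ` of the plane curve `V(F) ⊂ ℙ²` at `[b]` (the cone is locally a product along the ruling).
[folklore] -/
def VanishesToOrder {k : Type} [Field k] (F : MvPolynomial (Fin 3) k) (b : Fin 3 → k) (μ : ℕ) : Prop :=
  ∀ n < μ, MvPolynomial.homogeneousComponent n (MvPolynomial.aeval (fun i => MvPolynomial.X i + MvPolynomial.C (b i)) F) = 0

/-- [OURS · L1 W4.2] **`BirthTidy`** (elementary projective geometry, every characteristic): a non-zero ternary form of degree `d` with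
`2d < 3μ` does not vanish to order `μ` at three linearly independent vectors (three non-collinear points of `ℙ²`); SHARP (`(U₀U₁U₂)^k`).
WHY IT MIGHT FAIL: it does not (after the linear change making the vectors the coordinate points — `VanishesToOrder` is `GL₃`-equivariant —
vanishing to order `μ` at `e_t` says every monomial of `F` has `t`-exponent `≤ d − μ`; summing, `d ≤ 3(d − μ)`); the formal proof needs the
`GL₃` base change on `MvPolynomial (Fin 3) k` (M-sized). (OURS node — parameterless `Prop`, deliberately untagged so that the
gate does not relocate it to `Literature/`, precedent p496180; proved in `…Corridor3WLadderBirthForms.lean`.) -/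
def BirthTidy : Prop :=
  ∀ (k : Type) [Field k] (F : MvPolynomial (Fin 3) k) (d μ : ℕ), F.IsHomogeneous d → F ≠ 0 → 2 * d < 3 * μ →
    ∀ b : Fin 3 → (Fin 3 → k), LinearIndependent k b → (∀ t : Fin 3, VanishesToOrder F (b t) μ) → False

/-- [OURS · L1 W4.2] **`BirthNear`** (one coefficient, one chart; the typed form of (B-near)): if `c` has order `≥ d ≥ m − i` at the origin,
`c'·U_j^{m−i} = c(U_j·Û)` is its controlled transform in the `U_j`-chart, and `c'` has order `≥ m − i` at the point `(U_j = 0, U_l = b_l)` of the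
exceptional divisor, then the degree-`d` form `in_d(c)` vanishes to order `≥ 2(m − i) − d` at `b̂ = (b` with `b_j := 1)`. WHY IT MIGHT FAIL: it
does not (distinct powers of `U_j` do not cancel; the cone over `V(in_d c)` is a product along the ruling through `b̂`); S/M-sized. (OURS
node — parameterless `Prop`, deliberately untagged, precedent p496180; proved in `…Corridor3WLadderBirthForms.lean`.) -/
def BirthNear : Prop :=
  ∀ (k : Type) [Field k] (m i d : ℕ) (j : Fin 3) (b : Fin 3 → k) (c c' : MvPolynomial (Fin 3) k),
    i < m → m - i ≤ d → b j = 0 →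
    (∀ n < d, MvPolynomial.homogeneousComponent n c = 0) →
    c' * MvPolynomial.X j ^ (m - i) =
      MvPolynomial.aeval (fun l : Fin 3 => if l = j then (MvPolynomial.X j : MvPolynomial (Fin 3) k) else MvPolynomial.X j * MvPolynomial.X l) c →
    VanishesToOrder c' b (m - i) →
    VanishesToOrder (MvPolynomial.homogeneousComponent d c) (Function.update b j 1) (2 * (m - i) - d)

/-- [OURS] `BirthTidy`'s numerology: with `d_i = δ_i·n`, `μ_i = (2 − δ_i)·n` (`n = m − i`): `δ_i < 6/5 ⇔ 5·d_i < 6·n ⇔ 2·d_i < 3·(2n − d_i)`.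
[folklore] -/
theorem birth_band_iff (d n : ℕ) (hn : d ≤ 2 * n) : 5 * d < 6 * n ↔ 2 * d < 3 * (2 * n - d) := by
  omega

/-- [OURS] and the untidy-germ threshold: a near curve of degree `γ ≥ 3` needs `3·(2 − δ_i)·n ≤ δ_i·n`, i.e. `δ_i ≥ 3/2 ⇔ 3·(2n − d_i) ≤ d_i`.
[folklore] -/
theorem untidy_band_iff (d n : ℕ) (hn : d ≤ 2 * n) : 3 * n ≤ 2 * d ↔ 3 * (2 * n - d) ≤ d := by
  omega

end Summit.ResolutionOfSingularities.ResolutionOfSingularities.Theorems.SigmaMaxModificationsCorridor3.Birth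

end
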